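import Mathlib.Analysis.SpecialFunctions.Integrals.Basic
import Mathlib.Analysis.SpecialFunctions.Trigonometric.InverseDeriv
import Mathlib.Analysis.SpecialFunctions.Trigonometric.ArctanDeriv
import Mathlib.Analysis.SpecialFunctions.Sqrt
import Mathlib.MeasureTheory.Integral.IntervalIntegral.FundThmCalculus
import HarnessLib
import Literature.MathematicalPhysics.StatisticalMechanics.BoltzmannB4TwoCentreOpp

/-!
# Boltzmann's `B₄` for hard spheres — the two-centre integral, II: same-side inner integral

Companion of `BoltzmannB4TwoCentreOpp.lean` (see its header for the setting and references).
Here the two lens slices lie on the SAME side of the mid-plane: for `u, v ∈ (1/2, 1)` put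
`P = 1 − u²`, `Q = 1 − v²`, `R = 1 − (u − v)²`, with Heron quantity
`H = 4QR − (Q+R−P)² = 3 − 4u² + 4uv − 4v²` (`Hs`) — a quadratic in `v` whose roots are
`v± = u/2 ± K/8`, `K = √(48(1−u²))` (`vstar`, `vminus`, `Hs_eq_factor`). On the triangle region
`1/2 ≤ v < v*` the disc-pair measure is `π·k_s` with
`k_s = QR·A + PR·B + PQ·C − (P+Q+R)√H/4` (`kTri`), the angles being
`A = arctan(√H/N_A)`, `B = arctan(√H/N_B)` (`N_A = 1−2v²+2uv`, `N_B = 1−2u²+2uv`, both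
positive) and `C = arccos(N_C/(2√P√Q))`, `N_C = 1 − 2uv` (`angAs`, `angBs`, `angCs`); on the cap
region `v* ≤ v ≤ 1` it is `π²PQ` (there `√P + √Q ≤ √R`).

* `hasDerivAt_FinS` : on `{H > 0}` the explicit `FinS` (by parts on the angle terms with
  polynomial antiderivatives vanishing at `v = 1`, then the algebraic remainder
  `PH·√H + (76/15)·arcsin t − (16/15)·arcsin a₋ + e₊(u)·arcsin a₊ + e₋(u)·arcsin a_u`,
  `t = 4(2v−u)/K`, and `a₋, a₊, a_u` the arcsine antiderivatives at the poles `v = −1`,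
  `v = u + 1`, `v = u − 1` of the remainder; the residue at the fourth pole `v = 1` vanishes)
  has `∂/∂v FinS = k_s`;
* `FinS_vstar` : at `v = v*` one has `A = B = 0`, `C = π`, `√H = 0`, `t = 1`,
  `a₋ = 1`, `a₊ = −1`, `a_u = 1` (`angCs_vstar`, `argM_vstar`, …);
* `integral_kTri`, `integral_cap`, `integral_same_inner` :
  `∫_{1/2}^{v*} k_s dv + ∫_{v*}^1 π(1−u²)(1−v²) dv = −(π/16)(4 − e₊(u) + e₋(u)) − FinS u (1/2)`.

## References

* I. Lyberg, J. Stat. Phys. 119 (2005) 747–764, §3. [Lyberg2005]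
* B. R. A. Nijboer, L. van Hove, Phys. Rev. 85 (1952) 777–783. [NijboerVanhove1952]
-/

noncomputable section

open Real Set MeasureTheory intervalIntegral

namespace Literature.MathematicalPhysics.StatisticalMechanics

namespace BoltzmannB4.TwoCentre

/-! ### The same-side Heron polynomial `H = 3 − 4u² + 4uv − 4v²` and the cosine numerators -/

/-- `H(u,v) = 3 − 4u² + 4uv − 4v²` (`16Δ²` of the same-side slice triangle). [folklore] -/
def Hs (u v : ℝ) : ℝ := 3 - 4 * u ^ 2 + 4 * u * v - 4 * v ^ 2

/-- `N_A = 1 − 2v² + 2uv` (`= 2bc·cos A`). [folklore] -/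
def NAs (u v : ℝ) : ℝ := 1 - 2 * v ^ 2 + 2 * u * v

/-- `N_B = 1 − 2u² + 2uv` (`= 2ac·cos B`). [folklore] -/
def NBs (u v : ℝ) : ℝ := 1 - 2 * u ^ 2 + 2 * u * v

/-- `N_C = 1 − 2uv` (`= 2ab·cos C`). [folklore] -/
def NCs (u v : ℝ) : ℝ := 1 - 2 * u * v

/-- `∂H/∂v = 4u − 8v`. [folklore] -/
theorem hasDerivAt_Hs (u v : ℝ) : HasDerivAt (Hs u) (4 * u - 8 * v) v := by
  unfold Hs
  have h := (((hasDerivAt_id v).const_mul (4 * u)).const_add (3 - 4 * u ^ 2)).sub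
    ((hasDerivAt_pow 2 v).const_mul 4)
  refine (h.congr_of_eventuallyEq (Filter.Eventually.of_forall fun y => ?_)).congr_deriv ?_
  · simp only [id, Pi.sub_apply]
  · push_cast; ring

/-- `∂√H/∂v = (4u − 8v)/(2√H)` where `H > 0`. [folklore] -/
theorem hasDerivAt_sqrtHs {u v : ℝ} (hH : 0 < Hs u v) :
    HasDerivAt (fun v => √(Hs u v)) ((4 * u - 8 * v) / (2 * √(Hs u v))) v :=
  (hasDerivAt_Hs u v).sqrt hH.ne'

/-- `N_A > 0` on the open square `(1/2,1)²`. [folklore] -/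
theorem NAs_pos {u v : ℝ} (hu : u ∈ Ioo (1 / 2 : ℝ) 1) (hv : v ∈ Ioo (1 / 2 : ℝ) 1) :
    0 < NAs u v := by
  unfold NAs; obtain ⟨hu0, hu1⟩ := hu; obtain ⟨hv0, hv1⟩ := hv; nlinarith

/-- `N_B > 0` on the open square `(1/2,1)²`. [folklore] -/
theorem NBs_pos {u v : ℝ} (hu : u ∈ Ioo (1 / 2 : ℝ) 1) (hv : v ∈ Ioo (1 / 2 : ℝ) 1) :
    0 < NBs u v := by
  unfold NBs; obtain ⟨hu0, hu1⟩ := hu; obtain ⟨hv0, hv1⟩ := hv; nlinarith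

/-! ### The three angles of the same-side slice triangle -/

/-- Angle `A = arctan(√H/N_A)` (acute). [folklore] -/
def angAs (u v : ℝ) : ℝ := arctan (√(Hs u v) / NAs u v)

/-- Angle `B = arctan(√H/N_B)` (acute). [folklore] -/
def angBs (u v : ℝ) : ℝ := arctan (√(Hs u v) / NBs u v)

/-- Angle `C = arccos(N_C/(2√(1−u²)√(1−v²)))` (may be obtuse). [folklore] -/
def angCs (u v : ℝ) : ℝ := arccos (NCs u v / (2 * √(1 - u ^ 2) * √(1 - v ^ 2)))

/-- `∂A/∂v = ((4u−8v)N_A − 2H·N_A')/(8QR√H)` with `N_A² + H = 4QR`. [folklore] -/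
theorem hasDerivAt_angAs {u v : ℝ} (hu : u ∈ Ioo (1 / 2 : ℝ) 1) (hv : v ∈ Ioo (1 / 2 : ℝ) 1)
    (hH : 0 < Hs u v) :
    HasDerivAt (angAs u) (((4 * u - 8 * v) * NAs u v - 2 * Hs u v * (-4 * v + 2 * u)) /
      (8 * ((1 - v ^ 2) * (1 - (u - v) ^ 2)) * √(Hs u v))) v := by
  have hN : 0 < NAs u v := NAs_pos hu hv
  have hW : 0 < √(Hs u v) := Real.sqrt_pos.mpr hH
  have hW2 : √(Hs u v) ^ 2 = Hs u v := Real.sq_sqrt hH.le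
  have dN : HasDerivAt (NAs u) (-4 * v + 2 * u) v := by
    unfold NAs
    have h := (((hasDerivAt_pow 2 v).const_mul (-2 : ℝ)).const_add 1).add
      ((hasDerivAt_id v).const_mul (2 * u))
    refine (h.congr_of_eventuallyEq (Filter.Eventually.of_forall fun y => ?_)).congr_deriv ?_
    · simp only [id, Pi.add_apply]; ring
    · push_cast; ring
  have h1 := ((hasDerivAt_sqrtHs hH).div dN hN.ne').arctan
  unfold angAs
  refine h1.congr_deriv ?_
  simp only [Pi.div_apply]
  set W := √(Hs u v) with hWdef
  have key : NAs u v ^ 2 + W ^ 2 = 4 * ((1 - v ^ 2) * (1 - (u - v) ^ 2)) := by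
    rw [hW2]; unfold NAs Hs; ring
  have hQR : 0 < (1 - v ^ 2) * (1 - (u - v) ^ 2) := by
    obtain ⟨hu0, hu1⟩ := hu; obtain ⟨hv0, hv1⟩ := hv
    apply mul_pos <;> nlinarith
  have hden : 1 + (W / NAs u v) ^ 2 = 4 * ((1 - v ^ 2) * (1 - (u - v) ^ 2)) / NAs u v ^ 2 := by
    rw [← key]; field_simp
  rw [hden]
  field_simp
  rw [hW2]
  ring


/-- `∂B/∂v = ((4u−8v)N_B − 2H·N_B')/(8PR√H)` with `N_B² + H = 4PR`. [folklore] -/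
theorem hasDerivAt_angBs {u v : ℝ} (hu : u ∈ Ioo (1 / 2 : ℝ) 1) (hv : v ∈ Ioo (1 / 2 : ℝ) 1)
    (hH : 0 < Hs u v) :
    HasDerivAt (angBs u) (((4 * u - 8 * v) * NBs u v - 2 * Hs u v * (2 * u)) /
      (8 * ((1 - u ^ 2) * (1 - (u - v) ^ 2)) * √(Hs u v))) v := by
  have hN : 0 < NBs u v := NBs_pos hu hv
  have hW : 0 < √(Hs u v) := Real.sqrt_pos.mpr hH
  have hW2 : √(Hs u v) ^ 2 = Hs u v := Real.sq_sqrt hH.le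
  have dN : HasDerivAt (NBs u) (2 * u) v := by
    unfold NBs
    have h := ((hasDerivAt_id v).const_mul (2 * u)).const_add (1 - 2 * u ^ 2)
    refine (h.congr_of_eventuallyEq (Filter.Eventually.of_forall fun y => ?_)).congr_deriv ?_
    · simp only [id]
    · simp
  have h1 := ((hasDerivAt_sqrtHs hH).div dN hN.ne').arctan
  unfold angBs
  refine h1.congr_deriv ?_
  simp only [Pi.div_apply]
  set W := √(Hs u v) with hWdef
  have key : NBs u v ^ 2 + W ^ 2 = 4 * ((1 - u ^ 2) * (1 - (u - v) ^ 2)) := by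
    rw [hW2]; unfold NBs Hs; ring
  have hPR : 0 < (1 - u ^ 2) * (1 - (u - v) ^ 2) := by
    obtain ⟨hu0, hu1⟩ := hu; obtain ⟨hv0, hv1⟩ := hv
    apply mul_pos <;> nlinarith
  have hden : 1 + (W / NBs u v) ^ 2 = 4 * ((1 - u ^ 2) * (1 - (u - v) ^ 2)) / NBs u v ^ 2 := by
    rw [← key]; field_simp
  rw [hden]
  field_simp
  rw [hW2]
  ring

/-- `d/dv √(1 − v²) = −v/√(1 − v²)` for `|v| < 1`. [folklore] -/
theorem hasDerivAt_sqrt_one_sub_sq {v : ℝ} (hv : v ^ 2 < 1) :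
    HasDerivAt (fun v : ℝ => √(1 - v ^ 2)) (-v / √(1 - v ^ 2)) v := by
  have h : HasDerivAt (fun v : ℝ => 1 - v ^ 2) (-(2 * v)) v := by
    simpa using (hasDerivAt_pow 2 v).const_sub 1
  refine (h.sqrt (by linarith)).congr_deriv ?_
  field_simp

/-- `∂C/∂v = (2u − v)/((1 − v²)√H)` (arccosine chain rule; `1 − cos²C = H/(4PQ)`). [folklore] -/
theorem hasDerivAt_angCs {u v : ℝ} (hu : u ∈ Ioo (1 / 2 : ℝ) 1) (hv : v ∈ Ioo (1 / 2 : ℝ) 1)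
    (hH : 0 < Hs u v) :
    HasDerivAt (angCs u) ((2 * u - v) / ((1 - v ^ 2) * √(Hs u v))) v := by
  obtain ⟨hu0, hu1⟩ := hu
  obtain ⟨hv0, hv1⟩ := hv
  have hP : 0 < 1 - u ^ 2 := by nlinarith
  have hQ : 0 < 1 - v ^ 2 := by nlinarith
  have hp : 0 < √(1 - u ^ 2) := Real.sqrt_pos.mpr hP
  have hq : 0 < √(1 - v ^ 2) := Real.sqrt_pos.mpr hQ
  have hp2 : √(1 - u ^ 2) ^ 2 = 1 - u ^ 2 := Real.sq_sqrt hP.le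
  have hq2 : √(1 - v ^ 2) ^ 2 = 1 - v ^ 2 := Real.sq_sqrt hQ.le
  have hW : 0 < √(Hs u v) := Real.sqrt_pos.mpr hH
  have hW2 : √(Hs u v) ^ 2 = Hs u v := Real.sq_sqrt hH.le
  -- the argument and its derivative
  have dNC : HasDerivAt (NCs u) (-2 * u) v := by
    unfold NCs
    have h := ((hasDerivAt_id v).const_mul (-(2 * u))).const_add 1
    refine (h.congr_of_eventuallyEq (Filter.Eventually.of_forall fun y => ?_)).congr_deriv ?_
    · simp only [id]; ring
    · simp
  have dD : HasDerivAt (fun v : ℝ => 2 * √(1 - u ^ 2) * √(1 - v ^ 2))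
      (2 * √(1 - u ^ 2) * (-v / √(1 - v ^ 2))) v :=
    (hasDerivAt_sqrt_one_sub_sq (by nlinarith)).const_mul _
  have dx := dNC.div dD (by positivity)
  -- `1 - x² = (√H/(2√P√Q))²`
  set x := NCs u v / (2 * √(1 - u ^ 2) * √(1 - v ^ 2)) with hx
  have hm : 0 < √(Hs u v) / (2 * √(1 - u ^ 2) * √(1 - v ^ 2)) := by positivity
  have hmx : (√(Hs u v) / (2 * √(1 - u ^ 2) * √(1 - v ^ 2))) ^ 2 = 1 - x ^ 2 := by
    rw [hx, div_pow, div_pow, mul_pow, mul_pow, hp2, hq2, hW2]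
    field_simp
    unfold Hs NCs; ring
  have hlt : x ^ 2 < 1 := by nlinarith
  have hab : -1 < x ∧ x < 1 := by
    constructor <;> nlinarith [sq_nonneg (x + 1), sq_nonneg (x - 1)]
  have hsq : √(1 - x ^ 2) = √(Hs u v) / (2 * √(1 - u ^ 2) * √(1 - v ^ 2)) := by
    rw [← hmx, Real.sqrt_sq hm.le]
  have h := (Real.hasDerivAt_arccos hab.1.ne' hab.2.ne).comp v dx
  unfold angCs
  refine h.congr_deriv ?_
  rw [hsq]
  field_simp
  rw [hq2]
  unfold NCs
  ring

/-! ### The arcsine antiderivatives of the same-side remainder -/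

/-- `K(u) = √(48(1 − u²))` (`= 4√3·√(1−u²)`, the square root of the discriminant of `H` in `v`).
[folklore] -/
def Ks (u : ℝ) : ℝ := √(48 * (1 - u ^ 2))

/-- `K > 0` on `(1/2, 1)`. [folklore] -/
theorem Ks_pos {u : ℝ} (hu : u ∈ Ioo (1 / 2 : ℝ) 1) : 0 < Ks u := by
  obtain ⟨hu0, hu1⟩ := hu; exact Real.sqrt_pos.mpr (by nlinarith)

/-- `K² = 48(1 − u²)`. [folklore] -/
theorem Ks_sq {u : ℝ} (hu : u ∈ Ioo (1 / 2 : ℝ) 1) : Ks u ^ 2 = 48 * (1 - u ^ 2) := by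
  obtain ⟨hu0, hu1⟩ := hu; exact Real.sq_sqrt (by nlinarith)

/-- The argument `t = 4(2v − u)/K` of the polynomial-part arcsine (`∫dv/√H = ½ arcsin t`).
[folklore] -/
def targ (u v : ℝ) : ℝ := 4 * (2 * v - u) / Ks u

/-- `∂/∂v arcsin t = 2/√H`. [folklore] -/
theorem hasDerivAt_arcsin_targ {u v : ℝ} (hu : u ∈ Ioo (1 / 2 : ℝ) 1) (hH : 0 < Hs u v) :
    HasDerivAt (fun v => arcsin (targ u v)) (2 / √(Hs u v)) v := by
  have hK := Ks_pos hu
  have hK2 := Ks_sq hu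
  have hW : 0 < √(Hs u v) := Real.sqrt_pos.mpr hH
  have hW2 : √(Hs u v) ^ 2 = Hs u v := Real.sq_sqrt hH.le
  have ha : HasDerivAt (targ u) (8 / Ks u) v := by
    unfold targ
    have h := (((hasDerivAt_id v).const_mul (2 : ℝ)).sub_const u).const_mul 4 |>.div_const (Ks u)
    refine h.congr_deriv ?_
    ring
  have hm : 0 < 4 * √(Hs u v) / Ks u := by positivity
  refine (hasDerivAt_arcsin_of_sq ha hm ?_).congr_deriv ?_
  · unfold targ
    rw [div_pow, div_pow, mul_pow, mul_pow, hW2, hK2]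
    have h1u : (1 - u ^ 2) ≠ 0 := by obtain ⟨hu0, hu1⟩ := hu; nlinarith
    field_simp
    unfold Hs; ring
  · field_simp
    ring

/-- Pole `v = −1`: argument `n₋₁/((v+1)K)`, `n₋₁ = 6 + 8v − 4u + 4uv − 8u²`. [folklore] -/
def argM (u v : ℝ) : ℝ := (6 + 8 * v - 4 * u + 4 * u * v - 8 * u ^ 2) / ((v + 1) * Ks u)

/-- Pole `v = u + 1`: argument `n/((u+1−v)K)`, `n = 6 − 8v + 4u − 4uv − 4u²`. [folklore] -/
def argP (u v : ℝ) : ℝ := (6 - 8 * v + 4 * u - 4 * u * v - 4 * u ^ 2) / ((u + 1 - v) * Ks u)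

/-- Pole `v = u − 1`: argument `n/((v−u+1)K)`, `n = 6 + 8v − 4u − 4uv − 4u²`. [folklore] -/
def argU (u v : ℝ) : ℝ := (6 + 8 * v - 4 * u - 4 * u * v - 4 * u ^ 2) / ((v - u + 1) * Ks u)

/-- `∂/∂v arcsin argM = (1 + 2u)/((v+1)√H)`. [folklore] -/
theorem hasDerivAt_arcsin_argM {u v : ℝ} (hu : u ∈ Ioo (1 / 2 : ℝ) 1) (hv : v ∈ Ioo (1 / 2 : ℝ) 1)
    (hH : 0 < Hs u v) :
    HasDerivAt (fun v => arcsin (argM u v)) ((1 + 2 * u) / ((v + 1) * √(Hs u v))) v := by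
  obtain ⟨hu0, hu1⟩ := hu
  obtain ⟨hv0, hv1⟩ := hv
  have hK := Ks_pos ⟨hu0, hu1⟩
  have hK2 := Ks_sq ⟨hu0, hu1⟩
  have hW : 0 < √(Hs u v) := Real.sqrt_pos.mpr hH
  have hW2 : √(Hs u v) ^ 2 = Hs u v := Real.sq_sqrt hH.le
  have hd : 0 < v + 1 := by linarith
  have ha : HasDerivAt (argM u) (((8 + 4 * u) * ((v + 1) * Ks u) -
      (6 + 8 * v - 4 * u + 4 * u * v - 8 * u ^ 2) * Ks u) / ((v + 1) * Ks u) ^ 2) v := by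
    unfold argM
    have hN : HasDerivAt (fun v : ℝ => 6 + 8 * v - 4 * u + 4 * u * v - 8 * u ^ 2)
        (8 + 4 * u) v := by
      have h := ((((hasDerivAt_id v).const_mul (8 : ℝ)).const_add 6).sub_const (4 * u)).add
        ((hasDerivAt_id v).const_mul (4 * u)) |>.sub_const (8 * u ^ 2)
      refine (h.congr_of_eventuallyEq (Filter.Eventually.of_forall fun y => ?_)).congr_deriv ?_
      · simp only [id, Pi.add_apply]
      · simp
    have hD : HasDerivAt (fun v : ℝ => (v + 1) * Ks u) (Ks u) v := by
      simpa using ((hasDerivAt_id v).add_const 1).mul_const (Ks u)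
    exact hN.div hD (mul_pos hd hK).ne'
  have hm : 0 < 2 * (1 + 2 * u) * √(Hs u v) / ((v + 1) * Ks u) := by positivity
  refine (hasDerivAt_arcsin_of_sq ha hm ?_).congr_deriv ?_
  · unfold argM
    rw [div_pow, div_pow, mul_pow, mul_pow, mul_pow, hW2, hK2]
    have h1u : (1 - u ^ 2) ≠ 0 := by nlinarith
    field_simp
    unfold Hs; ring
  · field_simp
    ring

/-- `∂/∂v arcsin argP = −(1 + 2u)/((u+1−v)√H)`. [folklore] -/
theorem hasDerivAt_arcsin_argP {u v : ℝ} (hu : u ∈ Ioo (1 / 2 : ℝ) 1) (hv : v ∈ Ioo (1 / 2 : ℝ) 1)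
    (hH : 0 < Hs u v) :
    HasDerivAt (fun v => arcsin (argP u v)) (-(1 + 2 * u) / ((u + 1 - v) * √(Hs u v))) v := by
  obtain ⟨hu0, hu1⟩ := hu
  obtain ⟨hv0, hv1⟩ := hv
  have hK := Ks_pos ⟨hu0, hu1⟩
  have hK2 := Ks_sq ⟨hu0, hu1⟩
  have hW : 0 < √(Hs u v) := Real.sqrt_pos.mpr hH
  have hW2 : √(Hs u v) ^ 2 = Hs u v := Real.sq_sqrt hH.le
  have hd : 0 < u + 1 - v := by linarith
  have ha : HasDerivAt (argP u) (((-8 - 4 * u) * ((u + 1 - v) * Ks u) -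
      (6 - 8 * v + 4 * u - 4 * u * v - 4 * u ^ 2) * (-Ks u)) / ((u + 1 - v) * Ks u) ^ 2) v := by
    unfold argP
    have hN : HasDerivAt (fun v : ℝ => 6 - 8 * v + 4 * u - 4 * u * v - 4 * u ^ 2)
        (-8 - 4 * u) v := by
      have h := ((((hasDerivAt_id v).const_mul (8 : ℝ)).const_sub 6).add_const (4 * u)).sub
        ((hasDerivAt_id v).const_mul (4 * u)) |>.sub_const (4 * u ^ 2)
      refine (h.congr_of_eventuallyEq (Filter.Eventually.of_forall fun y => ?_)).congr_deriv ?_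
      · simp only [id, Pi.sub_apply]
      · simp
    have hD : HasDerivAt (fun v : ℝ => (u + 1 - v) * Ks u) (-Ks u) v := by
      simpa using ((hasDerivAt_id v).const_sub (u + 1)).mul_const (Ks u)
    exact hN.div hD (mul_pos hd hK).ne'
  have hm : 0 < 2 * (1 + 2 * u) * √(Hs u v) / ((u + 1 - v) * Ks u) := by positivity
  refine (hasDerivAt_arcsin_of_sq ha hm ?_).congr_deriv ?_
  · unfold argP
    rw [div_pow, div_pow, mul_pow, mul_pow, mul_pow, hW2, hK2]
    have h1u : (1 - u ^ 2) ≠ 0 := by nlinarith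
    field_simp
    unfold Hs; ring
  · field_simp
    ring

/-- `∂/∂v arcsin argU = (2u − 1)/((v−u+1)√H)`. [folklore] -/
theorem hasDerivAt_arcsin_argU {u v : ℝ} (hu : u ∈ Ioo (1 / 2 : ℝ) 1) (hv : v ∈ Ioo (1 / 2 : ℝ) 1)
    (hH : 0 < Hs u v) :
    HasDerivAt (fun v => arcsin (argU u v)) ((2 * u - 1) / ((v - u + 1) * √(Hs u v))) v := by
  obtain ⟨hu0, hu1⟩ := hu
  obtain ⟨hv0, hv1⟩ := hv
  have hK := Ks_pos ⟨hu0, hu1⟩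
  have hK2 := Ks_sq ⟨hu0, hu1⟩
  have hW : 0 < √(Hs u v) := Real.sqrt_pos.mpr hH
  have hW2 : √(Hs u v) ^ 2 = Hs u v := Real.sq_sqrt hH.le
  have hd : 0 < v - u + 1 := by linarith
  have hmu : 0 < 2 * u - 1 := by linarith
  have ha : HasDerivAt (argU u) (((8 - 4 * u) * ((v - u + 1) * Ks u) -
      (6 + 8 * v - 4 * u - 4 * u * v - 4 * u ^ 2) * Ks u) / ((v - u + 1) * Ks u) ^ 2) v := by
    unfold argU
    have hN : HasDerivAt (fun v : ℝ => 6 + 8 * v - 4 * u - 4 * u * v - 4 * u ^ 2)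
        (8 - 4 * u) v := by
      have h := ((((hasDerivAt_id v).const_mul (8 : ℝ)).const_add 6).sub_const (4 * u)).sub
        ((hasDerivAt_id v).const_mul (4 * u)) |>.sub_const (4 * u ^ 2)
      refine (h.congr_of_eventuallyEq (Filter.Eventually.of_forall fun y => ?_)).congr_deriv ?_
      · simp only [id, Pi.sub_apply]
      · simp
    have hD : HasDerivAt (fun v : ℝ => (v - u + 1) * Ks u) (Ks u) v := by
      simpa using (((hasDerivAt_id v).sub_const u).add_const 1).mul_const (Ks u)
    exact hN.div hD (mul_pos hd hK).ne'
  have hm : 0 < 2 * (2 * u - 1) * √(Hs u v) / ((v - u + 1) * Ks u) := by positivity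
  refine (hasDerivAt_arcsin_of_sq ha hm ?_).congr_deriv ?_
  · unfold argU
    rw [div_pow, div_pow, mul_pow, mul_pow, mul_pow, hW2, hK2]
    have h1u : (1 - u ^ 2) ≠ 0 := by nlinarith
    field_simp
    unfold Hs; ring
  · set μ := 2 * u - 1 with hμdef
    have hμ : μ ≠ 0 := hmu.ne'
    rw [div_eq_div_iff (by positivity) (by positivity)]
    field_simp
    rw [hμdef]
    ring


/-! ### The by-parts antiderivative of the same-side (triangle-region) integrand -/

/-- `F₁(u,v) = −∫_v^1 (1−t²)(1−(u−t)²) dt`. [folklore] -/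
def F1s (u v : ℝ) : ℝ :=
  (-(8 / 15 : ℝ) - (1 / 2) * u + (2 / 3) * u ^ 2) + (1 - u ^ 2) * v + u * v ^ 2 +
    (-(2 / 3 : ℝ) + (1 / 3) * u ^ 2) * v ^ 3 + (-(1 / 2) * u) * v ^ 4 + (1 / 5 : ℝ) * v ^ 5

/-- `F₂(u,v) = −∫_v^1 (1−(u−t)²) dt`. [folklore] -/
def F2s (u v : ℝ) : ℝ :=
  (-(2 / 3 : ℝ) - u + u ^ 2) + (1 - u ^ 2) * v + u * v ^ 2 + (-(1 / 3 : ℝ)) * v ^ 3 + 0 * v ^ 4 +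
    0 * v ^ 5

/-- `F₃(v) = −∫_v^1 (1−t²) dt`. [folklore] -/
def F3s (v : ℝ) : ℝ :=
  (-(2 / 3 : ℝ)) + 1 * v + 0 * v ^ 2 + (-(1 / 3 : ℝ)) * v ^ 3 + 0 * v ^ 4 + 0 * v ^ 5

/-- The polynomial multiplying `√H` in the algebraic part of the antiderivative. [folklore] -/
def PHs (u v : ℝ) : ℝ :=
  (-(5 / 3) * u + (6 / 5) * u ^ 3) + ((10 / 3 : ℝ) - (14 / 5) * u ^ 2) * v + ((6 / 5) * u) * v ^ 2 +
    (-(4 / 5 : ℝ)) * v ^ 3 + 0 * v ^ 4 + 0 * v ^ 5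

/-- Coefficient of `arcsin argP` (residue at `v = u+1` divided by `2u+1`). [folklore] -/
def epS (u : ℝ) : ℝ := (6 / 5) * u ^ 5 - 4 * u ^ 4 + (4 / 3) * u ^ 3 + 4 * u ^ 2

/-- Coefficient of `arcsin argU` (residue at `v = u−1` divided by `2u−1`). [folklore] -/
def euS (u : ℝ) : ℝ := -(6 / 5) * u ^ 5 + 4 * u ^ 4 - (4 / 3) * u ^ 3 - 4 * u ^ 2 + 16 / 15

/-- The algebraic (angle-free) part of the same-side antiderivative. [folklore] -/
def MS (u v : ℝ) : ℝ :=
  PHs u v * √(Hs u v) + (76 / 15 : ℝ) * arcsin (targ u v) + (-(16 / 15 : ℝ)) * arcsin (argM u v) +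
    epS u * arcsin (argP u v) + euS u * arcsin (argU u v)

/-- **The same-side integrand on the triangle region** `k_s = QR·A + PR·B + PQ·C − (P+Q+R)√H/4`,
`P = 1−u²`, `Q = 1−v²`, `R = 1−(u−v)²`. [folklore] -/
def kTri (u v : ℝ) : ℝ :=
  (1 - v ^ 2) * (1 - (u - v) ^ 2) * angAs u v + (1 - u ^ 2) * (1 - (u - v) ^ 2) * angBs u v +
    (1 - u ^ 2) * (1 - v ^ 2) * angCs u v -
    ((1 - u ^ 2) + (1 - v ^ 2) + (1 - (u - v) ^ 2)) * √(Hs u v) / 4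

/-- **Antiderivative in `v` of the same-side triangle-region integrand.** [folklore] -/
def FinS (u v : ℝ) : ℝ :=
  F1s u v * angAs u v + (1 - u ^ 2) * F2s u v * angBs u v + (1 - u ^ 2) * F3s v * angCs u v -
    MS u v / 8

/-- **`∂FinS/∂v = k_s`** on the triangle region `{H > 0}` of the open square `(1/2,1)²`.
[folklore] -/
theorem hasDerivAt_FinS {u v : ℝ} (hu : u ∈ Ioo (1 / 2 : ℝ) 1) (hv : v ∈ Ioo (1 / 2 : ℝ) 1)
    (hH : 0 < Hs u v) : HasDerivAt (FinS u) (kTri u v) v := by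
  have hu' := hu; have hv' := hv
  obtain ⟨hu0, hu1⟩ := hu
  obtain ⟨hv0, hv1⟩ := hv
  have hW : 0 < √(Hs u v) := Real.sqrt_pos.mpr hH
  have hW2 : √(Hs u v) ^ 2 = Hs u v := Real.sq_sqrt hH.le
  have hP : 0 < 1 - u ^ 2 := by nlinarith
  have hQ : 0 < 1 - v ^ 2 := by nlinarith
  have hR : 0 < 1 - (u - v) ^ 2 := by nlinarith
  have hd1 : 0 < v + 1 := by linarith
  have hd2 : 0 < u + 1 - v := by linarith
  have hd3 : 0 < v - u + 1 := by linarith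
  -- derivatives of the pieces
  have dF1 : HasDerivAt (F1s u) ((1 - u ^ 2) + 2 * u * v +
      3 * (-(2 / 3 : ℝ) + (1 / 3) * u ^ 2) * v ^ 2 +
      4 * (-(1 / 2) * u) * v ^ 3 + 5 * (1 / 5 : ℝ) * v ^ 4) v := hasDerivAt_poly5 _ _ _ _ _ _ v
  have dF2 : HasDerivAt (F2s u) ((1 - u ^ 2) + 2 * u * v + 3 * (-(1 / 3 : ℝ)) * v ^ 2 +
      4 * 0 * v ^ 3 +
      5 * 0 * v ^ 4) v := hasDerivAt_poly5 _ _ _ _ _ _ v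
  have dF3 : HasDerivAt F3s
      (1 + 2 * 0 * v + 3 * (-(1 / 3 : ℝ)) * v ^ 2 + 4 * 0 * v ^ 3 + 5 * 0 * v ^ 4) v :=
    hasDerivAt_poly5 _ _ _ _ _ _ v
  have dPH : HasDerivAt (PHs u) (((10 / 3 : ℝ) - (14 / 5) * u ^ 2) + 2 * ((6 / 5) * u) * v +
      3 * (-(4 / 5 : ℝ)) * v ^ 2 + 4 * 0 * v ^ 3 + 5 * 0 * v ^ 4) v :=
    hasDerivAt_poly5 _ _ _ _ _ _ v
  have dA := hasDerivAt_angAs hu' hv' hH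
  have dB := hasDerivAt_angBs hu' hv' hH
  have dC := hasDerivAt_angCs hu' hv' hH
  have dW := hasDerivAt_sqrtHs hH
  have dT := hasDerivAt_arcsin_targ hu' hH
  have dM := hasDerivAt_arcsin_argM hu' hv' hH
  have dPp := hasDerivAt_arcsin_argP hu' hv' hH
  have dU := hasDerivAt_arcsin_argU hu' hv' hH
  have dMS : HasDerivAt (MS u) _ v :=
    ((((dPH.mul dW).add (dT.const_mul (76 / 15 : ℝ))).add (dM.const_mul (-(16 / 15 : ℝ)))).add
      (dPp.const_mul (epS u))).add (dU.const_mul (euS u))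
  have hsum := ((((dF1.mul dA).add ((dF2.mul dB).const_mul (1 - u ^ 2))).add
    ((dF3.mul dC).const_mul (1 - u ^ 2))).sub (dMS.div_const 8))
  have hfun : FinS u = fun x => F1s u x * angAs u x + (1 - u ^ 2) * (F2s u x * angBs u x) +
      (1 - u ^ 2) * (F3s x * angCs u x) - MS u x / 8 := by
    funext x; simp only [FinS]; ring
  rw [hfun]
  refine hsum.congr_deriv ?_
  set W := √(Hs u v) with hWdef
  set A := angAs u v
  set B := angBs u v
  set C := angCs u v
  set L := F1s u v * ((4 * u - 8 * v) * NAs u v - 2 * Hs u v * (-4 * v + 2 * u)) /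
        (8 * ((1 - v ^ 2) * (1 - (u - v) ^ 2))) +
      (1 - u ^ 2) * F2s u v * ((4 * u - 8 * v) * NBs u v - 2 * Hs u v * (2 * u)) /
        (8 * ((1 - u ^ 2) * (1 - (u - v) ^ 2))) +
      (1 - u ^ 2) * F3s v * (2 * u - v) / (1 - v ^ 2) -
      ((((10 / 3 : ℝ) - (14 / 5) * u ^ 2) + 2 * ((6 / 5) * u) * v + 3 * (-(4 / 5 : ℝ)) * v ^ 2 +
          4 * 0 * v ^ 3 + 5 * 0 * v ^ 4) * W ^ 2 + PHs u v * (4 * u - 8 * v) / 2 + 152 / 15 -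
        (16 / 15 : ℝ) * (1 + 2 * u) / (v + 1) - epS u * (1 + 2 * u) / (u + 1 - v) +
        euS u * (2 * u - 1) / (v - u + 1)) / 8 +
      ((1 - u ^ 2) + (1 - v ^ 2) + (1 - (u - v) ^ 2)) * W ^ 2 / 4 with hL
  have hpoly : L = 0 := by
    rw [hL, hW2]
    simp only [F1s, F2s, F3s, PHs, epS, euS, NAs, NBs, Hs]
    field_simp
    ring
  rw [show kTri u v = kTri u v + 1 / W * L by rw [hpoly]; ring]
  simp only [kTri, hL]
  field_simp
  ring


/-! ### The triangle region `v < v*` and the values at its endpoints -/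

/-- `v*(u) = u/2 + K/8 = (u + √(3(1−u²)))/2`, the upper root of `H(u,·)`. [folklore] -/
def vstar (u : ℝ) : ℝ := u / 2 + Ks u / 8

/-- `v₋(u) = u/2 − K/8`, the lower root of `H(u,·)`. [folklore] -/
def vminus (u : ℝ) : ℝ := u / 2 - Ks u / 8

/-- **Factorisation of `H`**: `H(u,v) = 4(v* − v)(v − v₋)`. [folklore] -/
theorem Hs_eq_factor {u : ℝ} (hu : u ∈ Ioo (1 / 2 : ℝ) 1) (v : ℝ) :
    Hs u v = 4 * (vstar u - v) * (v - vminus u) := by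
  have hK2 := Ks_sq hu
  unfold Hs vstar vminus
  nlinarith [hK2]

/-- `v* < 1`. [folklore] -/
theorem vstar_lt_one {u : ℝ} (hu : u ∈ Ioo (1 / 2 : ℝ) 1) : vstar u < 1 := by
  have hK := Ks_pos hu
  have hK2 := Ks_sq hu
  obtain ⟨hu0, hu1⟩ := hu
  unfold vstar
  -- `K < 8 − 4u` since `K² = 48(1−u²) < (8−4u)²`
  have h : Ks u < 8 - 4 * u := by nlinarith
  linarith

/-- `1/2 < v*`. [folklore] -/
theorem half_lt_vstar {u : ℝ} (hu : u ∈ Ioo (1 / 2 : ℝ) 1) : 1 / 2 < vstar u := by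
  have hK := Ks_pos hu
  have hK2 := Ks_sq hu
  obtain ⟨hu0, hu1⟩ := hu
  unfold vstar
  -- `K > 4(1 − u)` since `K² = 48(1−u²) > 16(1−u)²`
  have h : 4 * (1 - u) < Ks u := by nlinarith
  linarith

/-- `v₋ < 1/2`. [folklore] -/
theorem vminus_lt_half {u : ℝ} (hu : u ∈ Ioo (1 / 2 : ℝ) 1) : vminus u < 1 / 2 := by
  have hK := Ks_pos hu
  obtain ⟨hu0, hu1⟩ := hu
  unfold vminus
  linarith

/-- `H > 0` on `[1/2, v*)`. [folklore] -/
theorem Hs_pos_of_lt_vstar {u v : ℝ} (hu : u ∈ Ioo (1 / 2 : ℝ) 1) (hv0 : 1 / 2 ≤ v)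
    (hv : v < vstar u) : 0 < Hs u v := by
  rw [Hs_eq_factor hu]
  have := vminus_lt_half hu
  apply mul_pos (mul_pos (by norm_num) (by linarith)) (by linarith)

/-- `H(u, v*) = 0`. [folklore] -/
theorem Hs_vstar {u : ℝ} (hu : u ∈ Ioo (1 / 2 : ℝ) 1) : Hs u (vstar u) = 0 := by
  rw [Hs_eq_factor hu]; ring

/-- `H < 0` beyond `v*`. [folklore] -/
theorem Hs_neg_of_vstar_lt {u v : ℝ} (hu : u ∈ Ioo (1 / 2 : ℝ) 1) (hv : vstar u < v) :
    Hs u v < 0 := by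
  rw [Hs_eq_factor hu]
  have := vminus_lt_half hu
  have := half_lt_vstar hu
  have h1 : 4 * (vstar u - v) < 0 := by linarith
  exact mul_neg_of_neg_of_pos h1 (by linarith)

/-- Heron's identity in the form `H = 4PQ − N_C²`. [folklore] -/
theorem Hs_eq_PQ (u v : ℝ) : Hs u v = 4 * ((1 - u ^ 2) * (1 - v ^ 2)) - NCs u v ^ 2 := by
  unfold Hs NCs; ring

/-- At `v*` the angle `C` is flat: `N_C(u,v*) < 0`. [folklore] -/
theorem NCs_vstar_neg {u : ℝ} (hu : u ∈ Ioo (1 / 2 : ℝ) 1) : NCs u (vstar u) < 0 := by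
  have hK := Ks_pos hu
  have hK2 := Ks_sq hu
  obtain ⟨hu0, hu1⟩ := hu
  unfold NCs vstar
  -- `2u·v* > 1 ⟸ u K > 4(1 − u²) ⟸ u²K² = 48u²(1−u²) > 16(1−u²)²`
  have h1 : 4 * (1 - u ^ 2) < u * Ks u := by
    have hsq : (4 * (1 - u ^ 2)) ^ 2 < (u * Ks u) ^ 2 := by
      rw [mul_pow u (Ks u), hK2]
      have h1 : 0 < 1 - u ^ 2 := by nlinarith
      have h2 : 0 < 4 * u ^ 2 - 1 := by nlinarith
      nlinarith [mul_pos h1 h2]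
    exact lt_of_pow_lt_pow_left₀ 2 (by positivity) hsq
  nlinarith

/-- `angCs u v* = π`. [folklore] -/
theorem angCs_vstar {u : ℝ} (hu : u ∈ Ioo (1 / 2 : ℝ) 1) : angCs u (vstar u) = π := by
  have hvs1 := vstar_lt_one hu
  have hvs0 := half_lt_vstar hu
  obtain ⟨hu0, hu1⟩ := hu
  have hP : 0 < 1 - u ^ 2 := by nlinarith
  have hQ : 0 < 1 - vstar u ^ 2 := by nlinarith
  have hN := NCs_vstar_neg ⟨hu0, hu1⟩
  have hH := Hs_vstar ⟨hu0, hu1⟩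
  rw [Hs_eq_PQ] at hH
  -- `N_C = -2√P√Q`
  have hsq : NCs u (vstar u) ^ 2 = (2 * √(1 - u ^ 2) * √(1 - vstar u ^ 2)) ^ 2 := by
    rw [mul_pow, mul_pow, Real.sq_sqrt hP.le, Real.sq_sqrt hQ.le]; linarith
  have hpos : 0 < 2 * √(1 - u ^ 2) * √(1 - vstar u ^ 2) := by positivity
  have hN' : NCs u (vstar u) = -(2 * √(1 - u ^ 2) * √(1 - vstar u ^ 2)) := by
    rcases (sq_eq_sq_iff_eq_or_eq_neg.mp hsq) with h | h
    · linarith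
    · exact h
  unfold angCs
  rw [hN', neg_div, div_self hpos.ne', Real.arccos_neg_one]

/-- `angAs u v* = 0` and `angBs u v* = 0` (`√H = 0`). [folklore] -/
theorem angAs_vstar {u : ℝ} (hu : u ∈ Ioo (1 / 2 : ℝ) 1) : angAs u (vstar u) = 0 := by
  unfold angAs; rw [Hs_vstar hu, Real.sqrt_zero, zero_div, Real.arctan_zero]

/-- `angBs u v* = 0`. [folklore] -/
theorem angBs_vstar {u : ℝ} (hu : u ∈ Ioo (1 / 2 : ℝ) 1) : angBs u (vstar u) = 0 := by
  unfold angBs; rw [Hs_vstar hu, Real.sqrt_zero, zero_div, Real.arctan_zero]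

/-- `targ u v* = 1`. [folklore] -/
theorem targ_vstar {u : ℝ} (hu : u ∈ Ioo (1 / 2 : ℝ) 1) : targ u (vstar u) = 1 := by
  have hK := Ks_pos hu
  unfold targ vstar
  field_simp
  ring

/-- The pole identities `(d·K)² − n² = 4μ²H` evaluated at `v*`: `argM u v* = 1`. [folklore] -/
theorem argM_vstar {u : ℝ} (hu : u ∈ Ioo (1 / 2 : ℝ) 1) : argM u (vstar u) = 1 := by
  have hK := Ks_pos hu
  have hK2 := Ks_sq hu
  have hvs0 := half_lt_vstar hu
  have hH := Hs_vstar hu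
  obtain ⟨hu0, hu1⟩ := hu
  set w := vstar u with hw
  have hd : 0 < w + 1 := by linarith
  have hn : 0 < 6 + 8 * w - 4 * u + 4 * u * w - 8 * u ^ 2 := by nlinarith
  -- `n² = ((w+1)K)²` from `H(u,w) = 0`
  have hsq : (6 + 8 * w - 4 * u + 4 * u * w - 8 * u ^ 2) ^ 2 = ((w + 1) * Ks u) ^ 2 := by
    have : ((w + 1) * Ks u) ^ 2 - (6 + 8 * w - 4 * u + 4 * u * w - 8 * u ^ 2) ^ 2 =
        4 * (1 + 2 * u) ^ 2 * Hs u w := by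
      rw [mul_pow, hK2]; unfold Hs; ring
    rw [hH, mul_zero, sub_eq_zero] at this
    exact this.symm
  have heq : 6 + 8 * w - 4 * u + 4 * u * w - 8 * u ^ 2 = (w + 1) * Ks u := by
    rcases (sq_eq_sq_iff_eq_or_eq_neg.mp hsq) with h | h
    · exact h
    · nlinarith [mul_pos hd hK]
  unfold argM
  rw [heq, div_self (mul_pos hd hK).ne']

/-- `argP u v* = −1`. [folklore] -/
theorem argP_vstar {u : ℝ} (hu : u ∈ Ioo (1 / 2 : ℝ) 1) : argP u (vstar u) = -1 := by
  have hK := Ks_pos hu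
  have hK2 := Ks_sq hu
  have hvs0 := half_lt_vstar hu
  have hvs1 := vstar_lt_one hu
  have hH := Hs_vstar hu
  obtain ⟨hu0, hu1⟩ := hu
  set w := vstar u with hw
  have hd : 0 < u + 1 - w := by linarith
  -- sign: `n < 0 ⟸ (2+u)K > 12(1−u²)`
  have hK12 : 12 * (1 - u ^ 2) < (2 + u) * Ks u := by
    have hsq : (12 * (1 - u ^ 2)) ^ 2 < ((2 + u) * Ks u) ^ 2 := by
      rw [mul_pow (2 + u) (Ks u), hK2]; nlinarith
    exact lt_of_pow_lt_pow_left₀ 2 (by positivity) hsq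
  have hn : 6 - 8 * w + 4 * u - 4 * u * w - 4 * u ^ 2 < 0 := by
    have : w = u / 2 + Ks u / 8 := hw
    rw [this]; nlinarith
  have hsq : (6 - 8 * w + 4 * u - 4 * u * w - 4 * u ^ 2) ^ 2 = ((u + 1 - w) * Ks u) ^ 2 := by
    have : ((u + 1 - w) * Ks u) ^ 2 - (6 - 8 * w + 4 * u - 4 * u * w - 4 * u ^ 2) ^ 2 =
        4 * (1 + 2 * u) ^ 2 * Hs u w := by
      rw [mul_pow, hK2]; unfold Hs; ring
    rw [hH, mul_zero, sub_eq_zero] at this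
    exact this.symm
  have heq : 6 - 8 * w + 4 * u - 4 * u * w - 4 * u ^ 2 = -((u + 1 - w) * Ks u) := by
    rcases (sq_eq_sq_iff_eq_or_eq_neg.mp hsq) with h | h
    · nlinarith [mul_pos hd hK]
    · exact h
  unfold argP
  rw [heq, neg_div, div_self (mul_pos hd hK).ne']

/-- `argU u v* = 1`. [folklore] -/
theorem argU_vstar {u : ℝ} (hu : u ∈ Ioo (1 / 2 : ℝ) 1) : argU u (vstar u) = 1 := by
  have hK := Ks_pos hu
  have hK2 := Ks_sq hu
  have hvs0 := half_lt_vstar hu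
  have hH := Hs_vstar hu
  obtain ⟨hu0, hu1⟩ := hu
  set w := vstar u with hw
  have hd : 0 < w - u + 1 := by linarith
  have hn : 0 < 6 + 8 * w - 4 * u - 4 * u * w - 4 * u ^ 2 := by nlinarith
  have hsq : (6 + 8 * w - 4 * u - 4 * u * w - 4 * u ^ 2) ^ 2 = ((w - u + 1) * Ks u) ^ 2 := by
    have : ((w - u + 1) * Ks u) ^ 2 - (6 + 8 * w - 4 * u - 4 * u * w - 4 * u ^ 2) ^ 2 =
        4 * (2 * u - 1) ^ 2 * Hs u w := by
      rw [mul_pow, hK2]; unfold Hs; ring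
    rw [hH, mul_zero, sub_eq_zero] at this
    exact this.symm
  have heq : 6 + 8 * w - 4 * u - 4 * u * w - 4 * u ^ 2 = (w - u + 1) * Ks u := by
    rcases (sq_eq_sq_iff_eq_or_eq_neg.mp hsq) with h | h
    · exact h
    · nlinarith [mul_pos hd hK]
  unfold argU
  rw [heq, div_self (mul_pos hd hK).ne']

/-- **Value of the same-side antiderivative at `v*`**: the angles are `0, 0, π`, `√H = 0` and the
four arcsines are `±π/2`. [folklore] -/
theorem FinS_vstar {u : ℝ} (hu : u ∈ Ioo (1 / 2 : ℝ) 1) :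
    FinS u (vstar u) = π * (1 - u ^ 2) * F3s (vstar u) - π / 16 * (4 - epS u + euS u) := by
  rw [FinS, MS, angAs_vstar hu, angBs_vstar hu, angCs_vstar hu, Hs_vstar hu, Real.sqrt_zero,
    targ_vstar hu, argM_vstar hu, argP_vstar hu, argU_vstar hu, Real.arcsin_one, Real.arcsin_neg,
    Real.arcsin_one]
  ring


/-! ### The same-side inner integral -/

/-- Positivity facts on the closed triangle segment `[1/2, v*] ⊂ [1/2, 1)`. [folklore] -/
theorem seg_facts {u x : ℝ} (hu : u ∈ Ioo (1 / 2 : ℝ) 1) (hx : x ∈ Icc (1 / 2 : ℝ) (vstar u)) :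
    x < 1 ∧ 0 < NAs u x ∧ 0 < NBs u x ∧ 0 < 1 - x ^ 2 ∧ 0 < x + 1 ∧ 0 < u + 1 - x ∧
      0 < x - u + 1 := by
  have hvs1 := vstar_lt_one hu
  obtain ⟨hu0, hu1⟩ := hu
  obtain ⟨hx0, hx1⟩ := hx
  have hx1' : x < 1 := lt_of_le_of_lt hx1 hvs1
  refine ⟨hx1', ?_, ?_, by nlinarith, by linarith, by linarith, by linarith⟩
  · unfold NAs; nlinarith
  · unfold NBs; nlinarith

/-- `FinS u` is continuous on `[1/2, v*]`. [folklore] -/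
theorem continuousOn_FinS {u : ℝ} (hu : u ∈ Ioo (1 / 2 : ℝ) 1) :
    ContinuousOn (FinS u) (Icc (1 / 2 : ℝ) (vstar u)) := by
  have hK := Ks_pos hu
  obtain ⟨hu0, hu1⟩ := hu
  have hP : 0 < 1 - u ^ 2 := by nlinarith
  have hp : 0 < √(1 - u ^ 2) := Real.sqrt_pos.mpr hP
  have hf := fun x (hx : x ∈ Icc (1 / 2 : ℝ) (vstar u)) => seg_facts ⟨hu0, hu1⟩ hx
  unfold FinS MS angAs angBs angCs targ argM argP argU F1s F2s F3s PHs epS euS NAs NBs NCs Hs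
  apply ContinuousOn.sub
  · apply ContinuousOn.add
    · apply ContinuousOn.add
      · apply ContinuousOn.mul (by fun_prop)
        apply Continuous.comp_continuousOn Real.continuous_arctan
        apply ContinuousOn.div (by fun_prop) (by fun_prop)
        intro x hx; exact (hf x hx).2.1.ne'
      · apply ContinuousOn.mul (by fun_prop)
        apply Continuous.comp_continuousOn Real.continuous_arctan
        apply ContinuousOn.div (by fun_prop) (by fun_prop)
        intro x hx; exact (hf x hx).2.2.1.ne'
    · apply ContinuousOn.mul (by fun_prop)
      apply Continuous.comp_continuousOn Real.continuous_arccos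
      apply ContinuousOn.div (by fun_prop) (by fun_prop)
      intro x hx
      exact (mul_pos (mul_pos two_pos hp) (Real.sqrt_pos.mpr (hf x hx).2.2.2.1)).ne'
  · apply ContinuousOn.div_const
    apply ContinuousOn.add
    · apply ContinuousOn.add
      · apply ContinuousOn.add
        · apply ContinuousOn.add
          · fun_prop
          · apply ContinuousOn.mul continuousOn_const
            apply Continuous.comp_continuousOn Real.continuous_arcsin
            fun_prop
        · apply ContinuousOn.mul continuousOn_const
          apply Continuous.comp_continuousOn Real.continuous_arcsin
          apply ContinuousOn.div (by fun_prop) (by fun_prop)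
          intro x hx; exact (mul_pos (hf x hx).2.2.2.2.1 hK).ne'
      · apply ContinuousOn.mul continuousOn_const
        apply Continuous.comp_continuousOn Real.continuous_arcsin
        apply ContinuousOn.div (by fun_prop) (by fun_prop)
        intro x hx; exact (mul_pos (hf x hx).2.2.2.2.2.1 hK).ne'
    · apply ContinuousOn.mul continuousOn_const
      apply Continuous.comp_continuousOn Real.continuous_arcsin
      apply ContinuousOn.div (by fun_prop) (by fun_prop)
      intro x hx; exact (mul_pos (hf x hx).2.2.2.2.2.2 hK).ne'

/-- `kTri u` is continuous on `[1/2, v*]`. [folklore] -/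
theorem continuousOn_kTri {u : ℝ} (hu : u ∈ Ioo (1 / 2 : ℝ) 1) :
    ContinuousOn (kTri u) (Icc (1 / 2 : ℝ) (vstar u)) := by
  obtain ⟨hu0, hu1⟩ := hu
  have hP : 0 < 1 - u ^ 2 := by nlinarith
  have hp : 0 < √(1 - u ^ 2) := Real.sqrt_pos.mpr hP
  have hf := fun x (hx : x ∈ Icc (1 / 2 : ℝ) (vstar u)) => seg_facts ⟨hu0, hu1⟩ hx
  unfold kTri angAs angBs angCs NAs NBs NCs Hs
  apply ContinuousOn.sub
  · apply ContinuousOn.add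
    · apply ContinuousOn.add
      · apply ContinuousOn.mul (by fun_prop)
        apply Continuous.comp_continuousOn Real.continuous_arctan
        apply ContinuousOn.div (by fun_prop) (by fun_prop)
        intro x hx; exact (hf x hx).2.1.ne'
      · apply ContinuousOn.mul (by fun_prop)
        apply Continuous.comp_continuousOn Real.continuous_arctan
        apply ContinuousOn.div (by fun_prop) (by fun_prop)
        intro x hx; exact (hf x hx).2.2.1.ne'
    · apply ContinuousOn.mul (by fun_prop)
      apply Continuous.comp_continuousOn Real.continuous_arccos
      apply ContinuousOn.div (by fun_prop) (by fun_prop)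
      intro x hx
      exact (mul_pos (mul_pos two_pos hp) (Real.sqrt_pos.mpr (hf x hx).2.2.2.1)).ne'
  · fun_prop

/-- **The same-side inner integral over the triangle region by the FTC**:
`∫_{1/2}^{v*} k_s(u,v) dv = FinS u v* − FinS u (1/2)`. [folklore] -/
theorem integral_kTri {u : ℝ} (hu : u ∈ Ioo (1 / 2 : ℝ) 1) :
    ∫ v in (1 / 2 : ℝ)..(vstar u), kTri u v = FinS u (vstar u) - FinS u (1 / 2) := by
  have hvs := half_lt_vstar hu
  have hvs1 := vstar_lt_one hu
  refine integral_eq_sub_of_hasDerivAt_of_le hvs.le (continuousOn_FinS hu) (fun v hv => ?_)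
    ((continuousOn_kTri hu).intervalIntegrable_of_Icc hvs.le)
  exact hasDerivAt_FinS hu ⟨hv.1, lt_trans hv.2 hvs1⟩ (Hs_pos_of_lt_vstar hu hv.1.le hv.2)

/-- `∂F₃/∂v = 1 − v²`. [folklore] -/
theorem hasDerivAt_F3s (v : ℝ) : HasDerivAt F3s (1 - v ^ 2) v := by
  have h : HasDerivAt F3s
      (1 + 2 * 0 * v + 3 * (-(1 / 3 : ℝ)) * v ^ 2 + 4 * 0 * v ^ 3 + 5 * 0 * v ^ 4) v :=
    hasDerivAt_poly5 _ _ _ _ _ _ v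
  refine h.congr_deriv ?_
  ring

/-- **The cap region** `v* ≤ v ≤ 1` (there `√P + √Q ≤ √R` and the disc-pair measure is
`π²PQ`): `∫_{v*}^1 π(1−u²)(1−v²) dv = −π(1−u²)F₃(v*)`. [folklore] -/
theorem integral_cap {u : ℝ} (hu : u ∈ Ioo (1 / 2 : ℝ) 1) :
    ∫ v in (vstar u)..1, π * (1 - u ^ 2) * (1 - v ^ 2) = -(π * (1 - u ^ 2) * F3s (vstar u)) := by
  have _ := hu
  rw [intervalIntegral.integral_const_mul,
    integral_eq_sub_of_hasDerivAt (fun v _ => hasDerivAt_F3s v)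
      ((by fun_prop : Continuous fun v : ℝ => 1 - v ^ 2).intervalIntegrable _ _)]
  have : F3s 1 = 0 := by unfold F3s; norm_num
  rw [this]
  ring

/-- **The same-side inner integral in closed form**: triangle region plus cap region,
`∫_{1/2}^{v*} k_s dv + ∫_{v*}^1 π(1−u²)(1−v²) dv = −(π/16)(4 − epS u + euS u) − FinS u (1/2)`
(the `v*`-dependent terms cancel). [folklore] -/
theorem integral_same_inner {u : ℝ} (hu : u ∈ Ioo (1 / 2 : ℝ) 1) :
    (∫ v in (1 / 2 : ℝ)..(vstar u), kTri u v) + ∫ v in (vstar u)..1, π * (1 - u ^ 2) * (1 - v ^ 2) =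
      -(π / 16) * (4 - epS u + euS u) - FinS u (1 / 2) := by
  rw [integral_kTri hu, integral_cap hu, FinS_vstar hu]
  ring

end BoltzmannB4.TwoCentre

end Literature.MathematicalPhysics.StatisticalMechanics
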